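import Summits.MatrixMultiplication.OmegaCensus.STPPKernelListerDataZ61
import Summits.MatrixMultiplication.OmegaCensus.STPPKernelListerSplit


/-!
# ω-census (abelian STPP census): kernel lister rows for `ℤ₆₁` (split form), file 60 of 74 (kernel computation)

HONEST FRAMING (pub-omega census; verbatim): lottery ticket; floor = certified bounds/negative ranges.
Census STRUCTURE (seat pub-omega-stpp-2 gen 29, 2026-08-29), family (b2).  One chunk of the root computation of the kernel lister at `n = 61` in SPLIT
form (`KLister.scanFirstSel2C`, `STPPKernelListerSplit.lean`): first block (2, 2, 4), second blocks in `sel2Z61S60` (130 shapes).  Twin estimate ≈ 116828 calls ≈ 75 s of kernel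
(HOME `pub-omega-stpp-2-g29/code/split_plan.py`, `klister_lean.py`).  Assembled in `STPPKernelListerCapstoneZ61.lean`.  Pure finite computation; nothing here is
progress on `ω`.
-/

namespace Summit.MatrixMultiplication.OmegaCensus.KLister

/-- First blocks of this file. [folklore] -/
def sel1Z61S60 : List Shape := [(2, 2, 4)]
/-- Second blocks of this file. [folklore] -/
def sel2Z61S60 : List Shape := [(2, 2, 15), (2, 3, 10), (2, 5, 6), (2, 6, 5), (2, 10, 3), (2, 15, 2), (3, 2, 10), (3, 4, 5), (3, 5, 4), (3, 10, 2), (4, 3, 5), (4, 5, 3), (5, 2, 6), (5, 3, 4), (5, 4, 3), (5, 6, 2), (6, 2, 5), (6, 5, 2), (10, 2, 3), (10, 3, 2), (15, 2, 2), (2, 2, 14), (2, 4, 7), (2, 7, 4), (2, 14, 2), (4, 2, 7), (4, 7, 2), (7, 2, 4), (7, 4, 2), (14, 2, 2), (2, 3, 9), (2, 9, 3), (3, 2, 9), (3, 3, 6), (3, 6, 3), (3, 9, 2), (6, 3, 3), (9, 2, 3), (9, 3, 2), (2, 2, 13), (2, 13, 2), (13, 2, 2), (2, 5, 5), (5, 2,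 5), (5, 5, 2), (2, 2, 12), (2, 3, 8), (2, 4, 6), (2, 6, 4), (2, 8, 3), (2, 12, 2), (3, 2, 8), (3, 4, 4), (3, 8, 2), (4, 2, 6), (4, 3, 4), (4, 4, 3), (4, 6, 2), (6, 2, 4), (6, 4, 2), (8, 2, 3), (8, 3, 2), (12, 2, 2), (3, 3, 5), (3, 5, 3), (5, 3, 3), (2, 2, 11), (2, 11, 2), (11, 2, 2), (2, 3, 7), (2, 7, 3), (3, 2, 7), (3, 7, 2), (7, 2, 3), (7, 3, 2), (2, 2, 10), (2, 4, 5), (2, 5, 4), (2, 10, 2), (4, 2, 5), (4, 5, 2), (5, 2, 4), (5, 4, 2), (10, 2, 2), (2, 2, 9), (2, 3, 6), (2, 6, 3), (2, 9, 2), (3, 2, 6), (3, 3, 4), (3, 4, 3), (3, 6, 2), (4, 3, 3), (6, 2, 3), (6, 3, 2), (9, 2, 2), (2, 2, 8), (2, 4, 4), (2, 8, 2), (4, 2, 4), (4, 4, 2), (8, 2, 2), (2, 3, 5), (2, 5, 3), (3, 2, 5), (3, 5, 2), (5, 2, 3), (5, 3, 2), (2, 2, 7), (2, 7, 2), (7,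 2, 2), (3, 3, 3), (2, 2, 6), (2, 3, 4), (2, 4, 3), (2, 6, 2), (3, 2, 4), (3, 4, 2), (4, 2, 3), (4, 3, 2), (6, 2, 2), (2, 2, 5), (2, 5, 2), (5, 2, 2), (2, 3, 3), (3, 2, 3), (3, 3, 2), (2, 2, 4), (2, 4, 2), (4, 2, 2)]

set_option maxRecDepth 32768 in
set_option maxHeartbeats 4000000 in
/-- Rows of the kernel lister at `61` (split form) for this file's selections. [folklore] -/
theorem scanSel_Z61_S60 :
    scanFirstSel2C 61 deadZ61 (fun s => sel1Z61S60.contains s) (fun t => sel2Z61S60.contains t) chunksZ61 = true := by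
  decide +kernel

end Summit.MatrixMultiplication.OmegaCensus.KLister
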